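import Mathlib
import Summits.Ventures.PercRepro2.HCov
import Summits.Ventures.PercRepro2.RootLeafUHalf
import Summits.Ventures.PercRepro2.RootLeafUTheorem
import Summits.Ventures.PercRepro2.RootLeafUMixK
import Summits.Ventures.PercRepro2.RootLeafUMixL
import Summits.Ventures.PercRepro2.RootLeafUMixSum
import Summits.Ventures.PercRepro2.RootLeafUMixMax
import Summits.Ventures.PercRepro2.RootLeafUMixHbThm
import Summits.Ventures.PercRepro2.RootLeafUMixHbLThm

/-!
# (G4-u): THE `hb`-MAX-OF-TWO CRITERION — `0 ≤ T2`, hence (HCOV) for a root pendant at an unmarked `u`, on the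
MARGINAL class «`max(lowK_hb, lowK₂)/P₀ + max(lowL_hb, lowL₂)/W ≥ 0`» (blind cell PercRepro2, p4 g14; S3 item
(aa); no definitions)

With the `hb`-bounds `lowK_hb = (A − 2β·hb)·ℋ′ + ℰ·(e0P₀ − d0P_o) ≤ P₀·T2oK` (`hb = P(a₂ ↔ b)`, RootLeafUMixHbThm)
and `lowL_hb = (|B| − 2β·hbL)·δ_o + (OU)·Y ≤ W·T2oL` (`hbL = P(u ↔ b)`, RootLeafUMixHbLThm) — the theorems
`0 ≤ hb·ℋ′ + X_b` and `0 ≤ hbL·δ_o + bracket`, i.e. the mixed-covariance bounds with `ρ = P(b ∈ my cluster)`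
— and the marginal second bounds `lowK₂`, `lowL₂` of RootLeafUMixMax, each half of `T2 = T2oL + T2oK` is at
least the larger of its two bounds (division forms `lowK_hb_div_le_T2oK`, `lowL_hb_div_le_T2oL`, valid in every
case), hence

* **`T2_nonneg_of_hb_max_criterion`**: `0 ≤ max (lowK_hb/P₀) (lowK₂/P₀) + max (lowL_hb/W) (lowL₂/W) → 0 ≤ T2`;
* **`HCov_root_leaf_u_of_hb_max_criterion`**: (G4-u) — (HCOV) at `(o, a₁, a₂, c, b)` for `a₁` pendant at `u` from
  (HCOV) at the smaller instance `(o, u, a₂, c, b)` — on that class.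

Every quantity in the criterion is a MARGINAL mass of the smaller instance.  CENSUS (own code hbclass.py, 900
random instances n ≤ 7, m ≤ 10, three palettes, exact): the criterion holds on **300 / 300 · 300 / 300 · 300 / 300**,
per side `max(lowK_hb, lowK₂) ≥ 0` and `max(lowL_hb, lowL₂) ≥ 0` on 300 / 300 each (the `hb`-sum criterion alone
95.3 / 93.3 / 94.0 %; the ρ = 1 classes of RootLeafUMixClass / RootLeafUMixSum / RootLeafUMixMaxThm 80 / 82–88 /
96–98 %).  The chain of record for (G4-u): `T2oK ≥ 0 ∧ T2oL ≥ 0 ⟸ the criterion`, an explicit inequality in the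
marginals — its universal validity is a census statement (engine twin ask filed).
-/

namespace Summit.Ventures.PercRepro2

open UnionCluster CovForm

namespace RootLeafU

namespace MixK

variable {V : Type*} {E : Type*} [Fintype E] [DecidableEq E] [Fintype V] [DecidableEq V]
  {R : Type*} [Field R] [LinearOrder R] [IsStrictOrderedRing R]

section Div

variable (p : E → R) (ends : E → Sym2 V) (o a₂ c b u : V)

/-- **`lowK_hb / P₀ ≤ T2oK` in every case**: for `P₀ > 0` from `lowK_hb_le_P0_mul_T2oK`; for `P₀ = 0` every
`PD`/`T′` mass vanishes, `T2oK = ℰ·e0 ≥ 0` and `lowK_hb / 0 = 0`. -/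
theorem lowK_hb_div_le_T2oK (hp : IsProbVec p) :
    ((((prob p (PDEvent ends u a₂ c) * prob p (connEvent ends a₂ b) +
            prob p (avoidAll ends a₂ {c}) * gap p ends u a₂ b) +
          (prob p Set.univ * EQb3 p ends u a₂ c b + prob p Set.univ * PDb p ends u a₂ c b +
            prob p (connEvent ends a₂ b) * EQ3 p ends u a₂ c +
            prob p (connEvent ends a₂ b) * prob p (avoidAll ends a₂ {u}) -
            (prob p Set.univ - prob p (avoidAll ends a₂ {c})) * gap p ends u a₂ b)) -
        2 * (prob p Set.univ * prob p (PDEvent ends u a₂ c) +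
          prob p (avoidAll ends a₂ {c}) * prob p (avoidAll ends a₂ {u})) *
          prob p (connEvent ends a₂ b)) *
        (prob p (TEvent ends a₂ u c) * prob p (PDEvent ends u a₂ c ∩ connEvent ends a₂ o) -
          prob p (PDEvent ends u a₂ c) * prob p (TEvent ends a₂ u c ∩ connEvent ends a₂ o)) +
      Ee p ends a₂ c b u *
        (prob p (avoidAll ends a₂ {c} ∩ connEvent ends a₂ o) *
            (prob p (PDEvent ends u a₂ c) + prob p (TEvent ends a₂ u c)) -
          prob p (avoidAll ends a₂ {c}) *
            (prob p (PDEvent ends u a₂ c ∩ connEvent ends a₂ o) +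
              prob p (TEvent ends a₂ u c ∩ connEvent ends a₂ o)))) /
      (prob p (PDEvent ends u a₂ c) + prob p (TEvent ends a₂ u c)) ≤ T2oK p ends o a₂ c b u := by
  have hlow := lowK_hb_le_P0_mul_T2oK p ends o a₂ c b u hp
  have hP0 : 0 ≤ prob p (PDEvent ends u a₂ c) + prob p (TEvent ends a₂ u c) :=
    add_nonneg (prob_nonneg hp _) (prob_nonneg hp _)
  rcases hP0.lt_or_eq with hpos | hzero
  · rw [div_le_iff₀ hpos]
    linarith [hlow]
  · -- `P₀ = 0`: `lowK_hb / 0 = 0` and `T2oK = ℰ·e0 ≥ 0`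
    have hz := hzero.symm
    rw [hz, div_zero]
    have hE := Ee_nonneg p ends a₂ c b u hp
    have he0 := prob_nonneg hp (avoidAll ends a₂ {c} ∩ connEvent ends a₂ o)
    unfold T2oK
    have h1 := prob_PD_eq_zero_of_P0 p ends a₂ c u hp hz (connEvent ends a₂ o)
    have h2 := prob_PD_eq_zero_of_P0 p ends a₂ c u hp hz (connEvent ends a₂ o ∩ connEvent ends a₂ b)
    have h3 := prob_PD_eq_zero_of_P0 p ends a₂ c u hp hz (connEvent ends a₂ o ∩ connEvent ends u b)
    rw [h1.1, h1.2, h2.2, h3.1, h3.2]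
    have := mul_nonneg hE he0
    linarith

end Div

end MixK

namespace MixL

variable {V : Type*} {E : Type*} [Fintype E] [DecidableEq E] [Fintype V] [DecidableEq V]
  {R : Type*} [Field R] [LinearOrder R] [IsStrictOrderedRing R]

section Div

variable (p : E → R) (ends : E → Sym2 V) (o a₂ c b u : V)

/-- **`lowL_hb / W ≤ T2oL` in every case**: for `W > 0` from `lowL_hb_le_W_mul_T2oL`; for `W = 0` every
`PD`/`T` mass vanishes, `T2oL = 0` and `lowL_hb / 0 = 0`. -/
theorem lowL_hb_div_le_T2oL (hp : IsProbVec p) :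
    (((prob p Set.univ * EQb3 p ends u a₂ c b + prob p Set.univ * PDb p ends u a₂ c b +
            prob p (connEvent ends a₂ b) * EQ3 p ends u a₂ c +
            prob p (connEvent ends a₂ b) * prob p (avoidAll ends a₂ {u}) -
            (prob p Set.univ - prob p (avoidAll ends a₂ {c})) * gap p ends u a₂ b) -
          (prob p (PDEvent ends u a₂ c) * prob p (connEvent ends a₂ b) +
            prob p (avoidAll ends a₂ {c}) * gap p ends u a₂ b) -
        2 * (prob p Set.univ * prob p (PDEvent ends u a₂ c) +
          prob p (avoidAll ends a₂ {c}) * prob p (avoidAll ends a₂ {u})) *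
          prob p (connEvent ends u b)) *
        (prob p (TEvent ends u a₂ c) * prob p (PDEvent ends u a₂ c ∩ connEvent ends u o) -
          prob p (PDEvent ends u a₂ c) * prob p (TEvent ends u a₂ c ∩ connEvent ends u o)) +
      T2oL p ends u a₂ c b u *
        (prob p (PDEvent ends u a₂ c ∩ connEvent ends u o) +
          prob p (TEvent ends u a₂ c ∩ connEvent ends u o))) /
      (prob p (PDEvent ends u a₂ c) + prob p (TEvent ends u a₂ c)) ≤ T2oL p ends o a₂ c b u := by
  have hlow := lowL_hb_le_W_mul_T2oL p ends o a₂ c b u hp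
  have hW : 0 ≤ prob p (PDEvent ends u a₂ c) + prob p (TEvent ends u a₂ c) :=
    add_nonneg (prob_nonneg hp _) (prob_nonneg hp _)
  rcases hW.lt_or_eq with hpos | hzero
  · rw [div_le_iff₀ hpos]
    linarith [hlow]
  · -- `W = 0`: `lowL_hb / 0 = 0` and `T2oL = 0`
    have hz := hzero.symm
    rw [hz, div_zero]
    have z : ∀ X : Set (Config E),
        prob p (PDEvent ends u a₂ c ∩ X) = 0 ∧ prob p (TEvent ends u a₂ c ∩ X) = 0 := by
      intro X
      have hD := prob_nonneg hp (PDEvent ends u a₂ c)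
      have hT := prob_nonneg hp (TEvent ends u a₂ c)
      have hDX := prob_inter_le_left hp (PDEvent ends u a₂ c) X
      have hTX := prob_inter_le_left hp (TEvent ends u a₂ c) X
      have hDX0 := prob_nonneg hp (PDEvent ends u a₂ c ∩ X)
      have hTX0 := prob_nonneg hp (TEvent ends u a₂ c ∩ X)
      constructor <;> linarith
    unfold T2oL
    rw [(z (connEvent ends u o)).1, (z (connEvent ends u o)).2,
      (z (connEvent ends u o ∩ connEvent ends u b)).2,
      (z (connEvent ends u o ∩ connEvent ends a₂ b)).1, (z (connEvent ends u o ∩ connEvent ends a₂ b)).2]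
    simp

end Div

end MixL

section Theorem

variable {V : Type*} {E : Type*} [Fintype E] [DecidableEq E] [Fintype V] [DecidableEq V]
  {R : Type*} [Field R] [LinearOrder R] [IsStrictOrderedRing R]
variable (p : E → R) (ends : E → Sym2 V) (o a₂ c b u : V)

/-- **`0 ≤ T2` on the marginal class `max(lowK_hb, lowK₂)/P₀ + max(lowL_hb, lowL₂)/W ≥ 0`** (contains the classes
of `T2_nonneg_of_max_criterion` and `T2_nonneg_of_sum_criterion`; 900 / 900 random instances). -/
theorem T2_nonneg_of_hb_max_criterion (hp : IsProbVec p)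
    (hmax : 0 ≤
      max (((((prob p (PDEvent ends u a₂ c) * prob p (connEvent ends a₂ b) +
            prob p (avoidAll ends a₂ {c}) * gap p ends u a₂ b) +
          (prob p Set.univ * EQb3 p ends u a₂ c b + prob p Set.univ * PDb p ends u a₂ c b +
            prob p (connEvent ends a₂ b) * EQ3 p ends u a₂ c +
            prob p (connEvent ends a₂ b) * prob p (avoidAll ends a₂ {u}) -
            (prob p Set.univ - prob p (avoidAll ends a₂ {c})) * gap p ends u a₂ b)) -
        2 * (prob p Set.univ * prob p (PDEvent ends u a₂ c) +
          prob p (avoidAll ends a₂ {c}) * prob p (avoidAll ends a₂ {u})) *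
          prob p (connEvent ends a₂ b)) *
        (prob p (TEvent ends a₂ u c) * prob p (PDEvent ends u a₂ c ∩ connEvent ends a₂ o) -
          prob p (PDEvent ends u a₂ c) * prob p (TEvent ends a₂ u c ∩ connEvent ends a₂ o)) +
      Ee p ends a₂ c b u *
        (prob p (avoidAll ends a₂ {c} ∩ connEvent ends a₂ o) *
            (prob p (PDEvent ends u a₂ c) + prob p (TEvent ends a₂ u c)) -
          prob p (avoidAll ends a₂ {c}) *
            (prob p (PDEvent ends u a₂ c ∩ connEvent ends a₂ o) +
              prob p (TEvent ends a₂ u c ∩ connEvent ends a₂ o)))) /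
        (prob p (PDEvent ends u a₂ c) + prob p (TEvent ends a₂ u c)))
        ((((prob p (PDEvent ends u a₂ c) * prob p (connEvent ends a₂ b) +
            prob p (avoidAll ends a₂ {c}) * gap p ends u a₂ b) +
          (prob p Set.univ * EQb3 p ends u a₂ c b + prob p Set.univ * PDb p ends u a₂ c b +
            prob p (connEvent ends a₂ b) * EQ3 p ends u a₂ c +
            prob p (connEvent ends a₂ b) * prob p (avoidAll ends a₂ {u}) -
            (prob p Set.univ - prob p (avoidAll ends a₂ {c})) * gap p ends u a₂ b)) *
        (prob p (TEvent ends a₂ u c) * prob p (PDEvent ends u a₂ c ∩ connEvent ends a₂ o) -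
          prob p (PDEvent ends u a₂ c) * prob p (TEvent ends a₂ u c ∩ connEvent ends a₂ o)) -
      2 * (prob p Set.univ * prob p (PDEvent ends u a₂ c) +
          prob p (avoidAll ends a₂ {c}) * prob p (avoidAll ends a₂ {u})) *
        (prob p (TEvent ends a₂ u c ∩ connEvent ends a₂ b) *
          (prob p (PDEvent ends u a₂ c ∩ connEvent ends a₂ o) +
            prob p (TEvent ends a₂ u c ∩ connEvent ends a₂ o))) +
      Ee p ends a₂ c b u *
        (prob p (avoidAll ends a₂ {c} ∩ connEvent ends a₂ o) *
            (prob p (PDEvent ends u a₂ c) + prob p (TEvent ends a₂ u c)) -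
          prob p (avoidAll ends a₂ {c}) *
            (prob p (PDEvent ends u a₂ c ∩ connEvent ends a₂ o) +
              prob p (TEvent ends a₂ u c ∩ connEvent ends a₂ o)))) /
        (prob p (PDEvent ends u a₂ c) + prob p (TEvent ends a₂ u c))) +
      max ((((prob p Set.univ * EQb3 p ends u a₂ c b + prob p Set.univ * PDb p ends u a₂ c b +
            prob p (connEvent ends a₂ b) * EQ3 p ends u a₂ c +
            prob p (connEvent ends a₂ b) * prob p (avoidAll ends a₂ {u}) -
            (prob p Set.univ - prob p (avoidAll ends a₂ {c})) * gap p ends u a₂ b) -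
          (prob p (PDEvent ends u a₂ c) * prob p (connEvent ends a₂ b) +
            prob p (avoidAll ends a₂ {c}) * gap p ends u a₂ b) -
        2 * (prob p Set.univ * prob p (PDEvent ends u a₂ c) +
          prob p (avoidAll ends a₂ {c}) * prob p (avoidAll ends a₂ {u})) *
          prob p (connEvent ends u b)) *
        (prob p (TEvent ends u a₂ c) * prob p (PDEvent ends u a₂ c ∩ connEvent ends u o) -
          prob p (PDEvent ends u a₂ c) * prob p (TEvent ends u a₂ c ∩ connEvent ends u o)) +
      T2oL p ends u a₂ c b u *
        (prob p (PDEvent ends u a₂ c ∩ connEvent ends u o) +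
          prob p (TEvent ends u a₂ c ∩ connEvent ends u o))) /
        (prob p (PDEvent ends u a₂ c) + prob p (TEvent ends u a₂ c)))
        ((((prob p Set.univ * EQb3 p ends u a₂ c b + prob p Set.univ * PDb p ends u a₂ c b +
            prob p (connEvent ends a₂ b) * EQ3 p ends u a₂ c +
            prob p (connEvent ends a₂ b) * prob p (avoidAll ends a₂ {u}) -
            (prob p Set.univ - prob p (avoidAll ends a₂ {c})) * gap p ends u a₂ b) -
          (prob p (PDEvent ends u a₂ c) * prob p (connEvent ends a₂ b) +
            prob p (avoidAll ends a₂ {c}) * gap p ends u a₂ b)) *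
        (prob p (TEvent ends u a₂ c) * prob p (PDEvent ends u a₂ c ∩ connEvent ends u o) -
          prob p (PDEvent ends u a₂ c) * prob p (TEvent ends u a₂ c ∩ connEvent ends u o)) -
      2 * (prob p Set.univ * prob p (PDEvent ends u a₂ c) +
          prob p (avoidAll ends a₂ {c}) * prob p (avoidAll ends a₂ {u})) *
        (prob p (TEvent ends u a₂ c ∩ connEvent ends u b) *
          (prob p (PDEvent ends u a₂ c ∩ connEvent ends u o) +
            prob p (TEvent ends u a₂ c ∩ connEvent ends u o))) +
      T2oL p ends u a₂ c b u *
        (prob p (PDEvent ends u a₂ c ∩ connEvent ends u o) +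
          prob p (TEvent ends u a₂ c ∩ connEvent ends u o))) /
        (prob p (PDEvent ends u a₂ c) + prob p (TEvent ends u a₂ c)))) :
    0 ≤ T2 p ends o a₂ c b u := by
  have hK1 := MixK.lowK_hb_div_le_T2oK p ends o a₂ c b u hp
  have hK2 := MixK.lowK2_div_le_T2oK p ends o a₂ c b u hp
  have hL1 := MixL.lowL_hb_div_le_T2oL p ends o a₂ c b u hp
  have hL2 := MixL.lowL2_div_le_T2oL p ends o a₂ c b u hp
  have hK := max_le hK1 hK2
  have hL := max_le hL1 hL2
  rw [T2_eq_T2oL_add_T2oK]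
  linarith

/-- **(G4-u) on the `hb`-marginal class**: (HCOV) for a root `a₁` pendant at the unmarked `u` follows from (HCOV)
at the smaller instance `(o, u, a₂, c, b)` whenever `max(lowK_hb, lowK₂)/P₀ + max(lowL_hb, lowL₂)/W ≥ 0` there. -/
theorem HCov_root_leaf_u_of_hb_max_criterion (hp : IsProbVec p) {f : E} {a₁ : V} (hf : ends f = s(a₁, u))
    (hleaf : ∀ e, a₁ ∈ ends e → e = f) (h1u : a₁ ≠ u) (h12 : a₁ ≠ a₂) (h1c : a₁ ≠ c)
    (h1o : a₁ ≠ o) (h1b : a₁ ≠ b)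
    (hmax : 0 ≤
      max (((((prob p (PDEvent ends u a₂ c) * prob p (connEvent ends a₂ b) +
            prob p (avoidAll ends a₂ {c}) * gap p ends u a₂ b) +
          (prob p Set.univ * EQb3 p ends u a₂ c b + prob p Set.univ * PDb p ends u a₂ c b +
            prob p (connEvent ends a₂ b) * EQ3 p ends u a₂ c +
            prob p (connEvent ends a₂ b) * prob p (avoidAll ends a₂ {u}) -
            (prob p Set.univ - prob p (avoidAll ends a₂ {c})) * gap p ends u a₂ b)) -
        2 * (prob p Set.univ * prob p (PDEvent ends u a₂ c) +
          prob p (avoidAll ends a₂ {c}) * prob p (avoidAll ends a₂ {u})) *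
          prob p (connEvent ends a₂ b)) *
        (prob p (TEvent ends a₂ u c) * prob p (PDEvent ends u a₂ c ∩ connEvent ends a₂ o) -
          prob p (PDEvent ends u a₂ c) * prob p (TEvent ends a₂ u c ∩ connEvent ends a₂ o)) +
      Ee p ends a₂ c b u *
        (prob p (avoidAll ends a₂ {c} ∩ connEvent ends a₂ o) *
            (prob p (PDEvent ends u a₂ c) + prob p (TEvent ends a₂ u c)) -
          prob p (avoidAll ends a₂ {c}) *
            (prob p (PDEvent ends u a₂ c ∩ connEvent ends a₂ o) +
              prob p (TEvent ends a₂ u c ∩ connEvent ends a₂ o)))) /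
        (prob p (PDEvent ends u a₂ c) + prob p (TEvent ends a₂ u c)))
        ((((prob p (PDEvent ends u a₂ c) * prob p (connEvent ends a₂ b) +
            prob p (avoidAll ends a₂ {c}) * gap p ends u a₂ b) +
          (prob p Set.univ * EQb3 p ends u a₂ c b + prob p Set.univ * PDb p ends u a₂ c b +
            prob p (connEvent ends a₂ b) * EQ3 p ends u a₂ c +
            prob p (connEvent ends a₂ b) * prob p (avoidAll ends a₂ {u}) -
            (prob p Set.univ - prob p (avoidAll ends a₂ {c})) * gap p ends u a₂ b)) *
        (prob p (TEvent ends a₂ u c) * prob p (PDEvent ends u a₂ c ∩ connEvent ends a₂ o) -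
          prob p (PDEvent ends u a₂ c) * prob p (TEvent ends a₂ u c ∩ connEvent ends a₂ o)) -
      2 * (prob p Set.univ * prob p (PDEvent ends u a₂ c) +
          prob p (avoidAll ends a₂ {c}) * prob p (avoidAll ends a₂ {u})) *
        (prob p (TEvent ends a₂ u c ∩ connEvent ends a₂ b) *
          (prob p (PDEvent ends u a₂ c ∩ connEvent ends a₂ o) +
            prob p (TEvent ends a₂ u c ∩ connEvent ends a₂ o))) +
      Ee p ends a₂ c b u *
        (prob p (avoidAll ends a₂ {c} ∩ connEvent ends a₂ o) *
            (prob p (PDEvent ends u a₂ c) + prob p (TEvent ends a₂ u c)) -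
          prob p (avoidAll ends a₂ {c}) *
            (prob p (PDEvent ends u a₂ c ∩ connEvent ends a₂ o) +
              prob p (TEvent ends a₂ u c ∩ connEvent ends a₂ o)))) /
        (prob p (PDEvent ends u a₂ c) + prob p (TEvent ends a₂ u c))) +
      max ((((prob p Set.univ * EQb3 p ends u a₂ c b + prob p Set.univ * PDb p ends u a₂ c b +
            prob p (connEvent ends a₂ b) * EQ3 p ends u a₂ c +
            prob p (connEvent ends a₂ b) * prob p (avoidAll ends a₂ {u}) -
            (prob p Set.univ - prob p (avoidAll ends a₂ {c})) * gap p ends u a₂ b) -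
          (prob p (PDEvent ends u a₂ c) * prob p (connEvent ends a₂ b) +
            prob p (avoidAll ends a₂ {c}) * gap p ends u a₂ b) -
        2 * (prob p Set.univ * prob p (PDEvent ends u a₂ c) +
          prob p (avoidAll ends a₂ {c}) * prob p (avoidAll ends a₂ {u})) *
          prob p (connEvent ends u b)) *
        (prob p (TEvent ends u a₂ c) * prob p (PDEvent ends u a₂ c ∩ connEvent ends u o) -
          prob p (PDEvent ends u a₂ c) * prob p (TEvent ends u a₂ c ∩ connEvent ends u o)) +
      T2oL p ends u a₂ c b u *
        (prob p (PDEvent ends u a₂ c ∩ connEvent ends u o) +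
          prob p (TEvent ends u a₂ c ∩ connEvent ends u o))) /
        (prob p (PDEvent ends u a₂ c) + prob p (TEvent ends u a₂ c)))
        ((((prob p Set.univ * EQb3 p ends u a₂ c b + prob p Set.univ * PDb p ends u a₂ c b +
            prob p (connEvent ends a₂ b) * EQ3 p ends u a₂ c +
            prob p (connEvent ends a₂ b) * prob p (avoidAll ends a₂ {u}) -
            (prob p Set.univ - prob p (avoidAll ends a₂ {c})) * gap p ends u a₂ b) -
          (prob p (PDEvent ends u a₂ c) * prob p (connEvent ends a₂ b) +
            prob p (avoidAll ends a₂ {c}) * gap p ends u a₂ b)) *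
        (prob p (TEvent ends u a₂ c) * prob p (PDEvent ends u a₂ c ∩ connEvent ends u o) -
          prob p (PDEvent ends u a₂ c) * prob p (TEvent ends u a₂ c ∩ connEvent ends u o)) -
      2 * (prob p Set.univ * prob p (PDEvent ends u a₂ c) +
          prob p (avoidAll ends a₂ {c}) * prob p (avoidAll ends a₂ {u})) *
        (prob p (TEvent ends u a₂ c ∩ connEvent ends u b) *
          (prob p (PDEvent ends u a₂ c ∩ connEvent ends u o) +
            prob p (TEvent ends u a₂ c ∩ connEvent ends u o))) +
      T2oL p ends u a₂ c b u *
        (prob p (PDEvent ends u a₂ c ∩ connEvent ends u o) +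
          prob p (TEvent ends u a₂ c ∩ connEvent ends u o))) /
        (prob p (PDEvent ends u a₂ c) + prob p (TEvent ends u a₂ c))))
    (h3 : HCov p ends o u a₂ c b) : HCov p ends o a₁ a₂ c b :=
  HCov_root_leaf_u_of p ends hp hf hleaf h1u h12 h1c h1o h1b
    (T2_nonneg_of_hb_max_criterion p ends o a₂ c b u hp hmax) h3

end Theorem

end RootLeafU

end Summit.Ventures.PercRepro2
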